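import Summits.QuantumFields.BalabanUV.Beta.FP.KernelPeriodisationFibTraceTwoBound
import Summits.QuantumFields.BalabanUV.Beta.FP.KernelLawDeperiodised
import Summits.QuantumFields.BalabanUV.Beta.D1BFx.MixedVarPackedHess
import Literature.MathematicalPhysics.QuantumFieldTheory.Balaban1983to89.Beta.KernelWard

/-!
# `BalabanUV.Beta.FP.KernelPeriodisationFibHessKer` — road «FP» (binder row D1), ROUTE T, (T-PER) PART 4‴ = **(P2‴): THE TORUS ONE-LOOP FUNCTIONAL
# `hessT` OF THE PERIODISED LEG AGAINST PERIODISED JETS CONVERGES TO `ExpKernelCalculus.hessKer`**, in the `perF ∕ dper ∕ Mk` currency of the OWNER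
# d1-p3's #20–#27 and of (P2″) (`KernelPeriodisationFibTraceTwo{,Bound}`); the OWNER d1-p3 g21's X4 INFO (e) (HOME/CLAIMS.log l.46142: «a
# `tendsto_trace_tadpole` corollary would make the tadpole half one term too») and R-FP-57 (R2) (the three de-periodised kernels of (L1) ARE `hessKer`-words:
# `TshotOf Lc Jc (j+1)`, `Lc⁸·dressedEntry …`, `TbalOf Lc Js j` — `OneStepResolventKernel.TOf ∕ CombChartJointEnd`)

WHY.  TID § F.8 STEP 3 ∕ § F.10 (L1): after #24 `KernelDoorLegCurrency.hessT_kernel_law_of_secondVar_law_graded` the (STEP) door on the torus `Mk k` is a law of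
three numbers `hessT L_X v_X(a) v_X(b) w_X(a,b)` (`X = N, F, G`; `hessT L V V′ W = ½(tr(L·W) − tr(L·V·(L·V′)))`, road BF-x TA4); once legs and jets are written
as `perF (Mk k) A` ∕ `perF (Mk k) (dper (Mk k) ·)` ((B2): leaf-05's `PackedLegBlocksAtSlices` + the (J-a) naming), #23 `KernelLawDeperiodised.law_of_tendsto`
wants ONE `Tendsto` per system.  (P2″) F2 gave the BUBBLE's (`tendsto_trace_bubble`) and the two-insertion word's; this file adds the TADPOLE's, packages
`½(tadpole − bubble)` as ONE limit `hessT (perF A) (perF (dper U)) (perF (dper V)) (perF (dper W)) → ½(tadpole A W − bubble A U V)`, reads it for the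
base-point jet families of `ExpKernelCalculus.hessKer` as `→ hessKer A 𝒱 𝒲 μ ν z` (the END's `TOf ∕ TshotOf` currency), and composes with #23: a torus
`hessT`-law on every `Mk k` ⟹ the LATTICE law `hessKer A_N 𝒱_N 𝒲_N μ ν z = hessKer A_F … + hessKer A_G …`.
ROAD BF-x PRECEDENT (NOT restated, NOT importable across currencies without a dictionary): `D1BFx.TorusTraceTadpole.tendsto_trace_tadpole ∕ _bubble ∕
tendsto_hessT_hessKer` (leaf-03, TA3b) prove the same three limits for `Matrix.of (periodiseF (σ k) (toF ·))` ∕ `arr (σ k)` along CUBIC periods `σ k → ∞`;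
this road's objects are `perF M` ∕ `dper M` along BOXES `Mk : ℕ → (Fin (d+1) → ℕ)` with `∀ N, ∀ᶠ k, ∀ i, N ≤ Mk k i` (#23's sentence).
CONTENT ([folklore]; no `def`, no `def … : Prop`, nothing cited, 0 sorry; 0 estimates beyond (P2″)'s ∕ PART 4's displayed constants):
* §1 `tendsto_of_wrapAround` (the ε-step shared by every wrap-around estimate of PART 4 ∕ (P2″): `|a k − c| ≤ K·e^{−r·N}` whenever `∀ i, N ≤ Mk k i` ⟹ `a → c`);
  **`tendsto_trace_perF_dper`** (ONE insertion: PART 4's `abs_trace_perF_dper_sub_tr_le` as a limit); **`tendsto_trace_tadpole`** (`trace (perF A · perF (dper W)) →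
  tr (A ⋆ W) = tadpole A W`, from (P2″)'s `abs_trace_tadpole_sub_tr_le`).
* §2 `comp_bubbleWord_assoc` ∕ `tr_bubbleWord_eq_bubble` ((P2″)'s bubble word `((A⋆U)⋆A)⋆V` IS `(A⋆U)⋆(A⋆V)`, `KernelWard.comp_assoc_bdb` at the common rate
  `min (min α δU ∕ 2) δV`), `tendsto_trace_bubble'` (F2's bubble limit with value `bubble A U V`), `tendsto_trace_tadpole_sub_bubble`,
  **`tendsto_two_mul_hessT_perF`** ∕ **`tendsto_hessT_perF`** (`MixedVarPackedHess.two_mul_hessT` + `Matrix.mul_assoc` on the torus side).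
* §3 **`tendsto_hessT_perF_hessKer`**: for base-point jet families `𝒱 : Fin (d+1) → Site → MKer`, `𝒲 : Fin (d+1) → Site → Fin (d+1) → Site → MKer` with `𝒱 μ 0`,
  `𝒱 ν z`, `𝒲 μ 0 ν z` bi-localised: `hessT (perF (Mk k) A) (perF (dper (𝒱 μ 0))) (perF (dper (𝒱 ν z))) (perF (dper (𝒲 μ 0 ν z))) → hessKer A 𝒱 𝒲 μ ν z`.
* §4 **`hessKer_law_of_torus_hessT_law`**: three such systems, EACH ON ITS OWN box sequence `MkN MkF MkG` and fibre `FN FF FG` (the OWNER d1-p3 g22's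
  located ask W-FP-22-1, l.46427: the door hands `N, F` over on fine boxes and `G` on coarse boxes at the same `k`) + the torus `hessT`-law at every `k`
  ⟹ the lattice `hessKer`-law (#23 `law_of_tendsto` BY NAME); `two_hessT_limit_law_of_torus_law` (the same at the `tadpole − bubble` level for
  arbitrary bi-localised `U V W`, no family packaging).
What it is NOT: not the packed-sorts ↔ full-index transfer of #24's `X.submatrix e e` legs (`D1BFx.SortedEmbedding.hessT_submatrix_of_dead_leg`, leaf-03 g8, is the
generic letter), not the (J-a) naming «vertices = `perF (dper tables)`», not (C1)(C2), not (L1).  Moves NO (CONV-C) clause and NO row-D1 binder; NOT (T-ID), NOT SDF,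
NOT D1, NOT BetaPertH, NOT continuum, NOT Clay.

HONEST DEPENDENCY (page 1, mandatory): continuum YM on T⁴ ⇐ BetaPertH ∧ nine spine estimates (0/9 proved); BetaPertH ⇐ (D1) ∧ (D4) ∧ CAP+tail;
G-an2-4 gates asym, D1 and NE2/3/4.  HONEST FRAMING (cell contract, verbatim): «discharging `BetaPertH` makes Bałaban's UV stability UNCONDITIONAL —
a real constructive-QFT result; it is NOT the continuum limit and NOT the Clay problem.»  ABSOLUTE RULE (cell charter, verbatim): «No internally-minted
statement may enter as a cited fact. Every hypothesis is either kernel-proved in this package or a verbatim quotation of a PUBLISHED theorem with page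
reference. The manuscript(s) under audit are NOT citable for their own disputed steps — they are the thing under adjudication; programme-internal
(2001/route/tribunal) claims are never citable.»  Nothing of Bałaban's asserted.  D1 formalisation swarm LEAF PROVER 06 (b2b-balaban-beta-d1-formalise-leaf-06
gen 23), 2026-08-22.  No existing file touched.
-/

noncomputable section

open scoped BigOperators Matrix Topology
open Finset Filter

namespace Summit.QuantumFields.BalabanUV.Beta.FP.KernelPeriodisationFibHessKer

open Literature.MathematicalPhysics.QuantumFieldTheory.Balaban1983to89
open Literature.MathematicalPhysics.QuantumFieldTheory.Balaban1983to89.Beta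
open B4TorusKernel.MultiPeriod (translate)
open ExpKernelCalculus (MKer Decays BiLoc tr bubble tadpole hessKer)
open OneStepResolventKernel (biLoc_mono decays_mono)
open KernelWard (comp_assoc_bdb)
open Summit.QuantumFields.BalabanUV.Beta.D1BFx.MixedVarPackedHess (hessT two_mul_hessT)
open Summit.QuantumFields.BalabanUV.Beta.FP.KernelPeriodisationFib (perF)
open Summit.QuantumFields.BalabanUV.Beta.FP.KernelPeriodisationFibLoc (dper)
open Summit.QuantumFields.BalabanUV.Beta.FP.KernelPeriodisationFibTrace (abs_trace_perF_dper_sub_tr_le)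
open Summit.QuantumFields.BalabanUV.Beta.FP.KernelPeriodisationFibTraceTwoBound (biLoc_leg_comp abs_trace_tadpole_sub_tr_le tendsto_trace_bubble)

variable {d : ℕ} {F : Type*} [Fintype F]

/-! ## §1 The ε-step, the ONE-insertion limit and the TADPOLE limit -/

section Tadpole

variable {A X V : MKer (d + 1) F} {CA CV C α δV δ : ℝ} {p q p' q' : Fin (d + 1) → ℤ}

/-- [folklore] **THE ε-STEP SHARED BY EVERY WRAP-AROUND ESTIMATE**: along boxes `Mk` with `∀ N, ∀ᶠ k, ∀ i, N ≤ Mk k i` (#23's sentence), a sequence within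
`K·e^{−r·N}` (`r > 0`) of `c` whenever all periods of `Mk k` are `≥ N` tends to `c`. -/
theorem tendsto_of_wrapAround (Mk : ℕ → (Fin (d + 1) → ℕ)) (hMk : ∀ N : ℕ, ∀ᶠ k in atTop, ∀ i, N ≤ Mk k i)
    {a : ℕ → ℝ} {c K r : ℝ} (hr : 0 < r) (ha : ∀ (N k : ℕ), (∀ i, N ≤ Mk k i) → |a k - c| ≤ K * Real.exp (-(r * N))) :
    Tendsto a atTop (𝓝 c) := by
  have hlim : Tendsto (fun N : ℕ => K * Real.exp (-(r * N))) atTop (𝓝 0) := by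
    have h1 : Tendsto (fun N : ℕ => r * (N : ℝ)) atTop atTop := (tendsto_natCast_atTop_atTop).const_mul_atTop hr
    have h2 : Tendsto (fun N : ℕ => Real.exp (-(r * N))) atTop (𝓝 0) := Real.tendsto_exp_neg_atTop_nhds_zero.comp h1
    simpa using h2.const_mul K
  rw [Metric.tendsto_atTop]
  intro e he
  obtain ⟨N₀, hN₀⟩ := (Metric.tendsto_atTop.1 hlim) e he
  obtain ⟨k₀, hk₀⟩ := eventually_atTop.1 (hMk N₀)
  refine ⟨k₀, fun k hk => ?_⟩
  have h := hN₀ N₀ le_rfl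
  rw [Real.dist_eq, sub_zero] at h
  rw [Real.dist_eq]
  exact (ha N₀ k (hk₀ k hk)).trans_lt ((le_abs_self _).trans_lt h)

/-- [folklore] **`tendsto_trace_perF_dper` — ONE INSERTION**: for a bi-localised `X` (`BiLoc X p q C δ`, `δ > 0`), along growing boxes
`trace (perF (Mk k) (dper (Mk k) X)) → tr X` (PART 4's `abs_trace_perF_dper_sub_tr_le`, rate `δ∕2`, as a limit). -/
theorem tendsto_trace_perF_dper (Mk : ℕ → (Fin (d + 1) → ℕ)) [∀ k μ, NeZero (Mk k μ)] (hMk : ∀ N : ℕ, ∀ᶠ k in atTop, ∀ i, N ≤ Mk k i)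
    (hX : BiLoc X p q C δ) (hδ : 0 < δ) :
    Tendsto (fun k => Matrix.trace (perF (Mk k) (dper (Mk k) X))) atTop (𝓝 (tr X)) :=
  tendsto_of_wrapAround Mk hMk (half_pos hδ) fun _ k hk => abs_trace_perF_dper_sub_tr_le (Mk k) hX hδ hk

/-- [folklore] **`tendsto_trace_tadpole` — THE TADPOLE READ-OUT CONVERGES** (the OWNER d1-p3 g21's X4 INFO (e)): for an `Mkℤ`-invariant decaying leg `A`
and a bi-localised vertex `W`, `trace (perF (Mk k) A * perF (Mk k) (dper (Mk k) W)) → tr (A ⋆ W)` (= `tadpole A W` by `rfl`). -/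
theorem tendsto_trace_tadpole (Mk : ℕ → (Fin (d + 1) → ℕ)) [∀ k μ, NeZero (Mk k μ)] (hMk : ∀ N : ℕ, ∀ᶠ k in atTop, ∀ i, N ≤ Mk k i)
    (hA : Decays A CA α) (hα : 0 < α)
    (hAinv : ∀ k (m x y : Fin (d + 1) → ℤ) (a b : F), A (translate (Mk k) x m) (translate (Mk k) y m) a b = A x y a b)
    (hV : BiLoc V p' q' CV δV) (hδV : 0 < δV) :
    Tendsto (fun k => Matrix.trace (perF (Mk k) A * perF (Mk k) (dper (Mk k) V))) atTop (𝓝 (tr (ExpKernelCalculus.comp A V))) :=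
  tendsto_of_wrapAround Mk hMk (half_pos (half_pos (lt_min hα hδV)))
    fun _ k hk => abs_trace_tadpole_sub_tr_le (Mk k) hA hα (hAinv k) hV hδV hk

/-- [folklore] The same with the limit named `tadpole A W`. -/
theorem tendsto_trace_tadpole' (Mk : ℕ → (Fin (d + 1) → ℕ)) [∀ k μ, NeZero (Mk k μ)] (hMk : ∀ N : ℕ, ∀ᶠ k in atTop, ∀ i, N ≤ Mk k i)
    (hA : Decays A CA α) (hα : 0 < α)
    (hAinv : ∀ k (m x y : Fin (d + 1) → ℤ) (a b : F), A (translate (Mk k) x m) (translate (Mk k) y m) a b = A x y a b)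
    (hV : BiLoc V p' q' CV δV) (hδV : 0 < δV) :
    Tendsto (fun k => Matrix.trace (perF (Mk k) A * perF (Mk k) (dper (Mk k) V))) atTop (𝓝 (tadpole A V)) :=
  tendsto_trace_tadpole Mk hMk hA hα hAinv hV hδV

end Tadpole

/-! ## §2 The bubble word re-associated, and `½(tadpole − bubble)` as ONE limit of `hessT` -/

section HessT

variable {A U V W : MKer (d + 1) F} {CA CU CV CW α δU δV δW : ℝ} {p q p' q' p'' q'' : Fin (d + 1) → ℤ}

/-- [folklore] **(P2″)'s BUBBLE WORD RE-ASSOCIATED**: `((A ⋆ U) ⋆ A) ⋆ V = (A ⋆ U) ⋆ (A ⋆ V)` for a decaying leg and bi-localised insertions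
(`KernelWard.comp_assoc_bdb` at the common rate `γ = min (min α δU ∕ 2) δV`: `A ⋆ U` bi-localised at rate `min α δU ∕ 2` by (P2″)'s `biLoc_leg_comp`). -/
theorem comp_bubbleWord_assoc (hA : Decays A CA α) (hα : 0 < α) (hU : BiLoc U p q CU δU) (hδU : 0 < δU) (hV : BiLoc V p' q' CV δV) (hδV : 0 < δV) :
    ExpKernelCalculus.comp (ExpKernelCalculus.comp (ExpKernelCalculus.comp A U) A) V =
      ExpKernelCalculus.comp (ExpKernelCalculus.comp A U) (ExpKernelCalculus.comp A V) := by
  rcases isEmpty_or_nonempty F with hF | ⟨⟨a₀⟩⟩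
  · funext x z a b; exact (IsEmpty.false a).elim
  have hCA : 0 ≤ CA := hA.nonneg a₀
  have hCU : 0 ≤ CU := hU.nonneg a₀
  have hCV : 0 ≤ CV := hV.nonneg a₀
  have hγ : 0 < min (min α δU / 2) δV := lt_min (half_pos (lt_min hα hδU)) hδV
  have hAU := biLoc_leg_comp hA hU hCA hCU hα hδU
  have hP : BiLoc (ExpKernelCalculus.comp A U) p q
      ((Fintype.card F : ℝ) * (CA * CU) * ExpKernelCalculus.Zl (d + 1) (min α δU - min α δU / 2)) (min (min α δU / 2) δV) :=
    biLoc_mono hAU (mul_nonneg (by positivity) (ExpKernelCalculus.Zl_nonneg (by linarith [lt_min hα hδU]))) (min_le_left _ _)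
  have hA' : Decays A CA (min (min α δU / 2) δV) :=
    decays_mono hA hCA le_rfl ((min_le_left _ _).trans ((half_le_self (lt_min hα hδU).le).trans (min_le_left α δU)))
  have hV' : BiLoc V p' q' CV (min (min α δU / 2) δV) := biLoc_mono hV hCV (min_le_right _ _)
  exact (comp_assoc_bdb hP hA' hV' hγ).symm

/-- [folklore] **THE LATTICE VALUE OF (P2″)'s BUBBLE WORD IS `ExpKernelCalculus.bubble`**: `tr (((A ⋆ U) ⋆ A) ⋆ V) = bubble A U V`. -/
theorem tr_bubbleWord_eq_bubble (hA : Decays A CA α) (hα : 0 < α) (hU : BiLoc U p q CU δU) (hδU : 0 < δU) (hV : BiLoc V p' q' CV δV) (hδV : 0 < δV) :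
    tr (ExpKernelCalculus.comp (ExpKernelCalculus.comp (ExpKernelCalculus.comp A U) A) V) = bubble A U V := by
  rw [comp_bubbleWord_assoc hA hα hU hδU hV hδV]; rfl

/-- [folklore] **`tendsto_trace_bubble'` — F2's bubble limit with the value named `bubble A U V`.** -/
theorem tendsto_trace_bubble' (Mk : ℕ → (Fin (d + 1) → ℕ)) [∀ k μ, NeZero (Mk k μ)] (hMk : ∀ N : ℕ, ∀ᶠ k in atTop, ∀ i, N ≤ Mk k i)
    (hA : Decays A CA α) (hα : 0 < α)
    (hAinv : ∀ k (m x y : Fin (d + 1) → ℤ) (a b : F), A (translate (Mk k) x m) (translate (Mk k) y m) a b = A x y a b)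
    (hU : BiLoc U p q CU δU) (hδU : 0 < δU) (hV : BiLoc V p' q' CV δV) (hδV : 0 < δV) :
    Tendsto (fun k => Matrix.trace (perF (Mk k) A * perF (Mk k) (dper (Mk k) U) * perF (Mk k) A * perF (Mk k) (dper (Mk k) V))) atTop
      (𝓝 (bubble A U V)) := by
  rw [← tr_bubbleWord_eq_bubble hA hα hU hδU hV hδV]
  exact tendsto_trace_bubble Mk hMk hA hα hAinv hU hδU hV hδV

/-- [folklore] **`tendsto_trace_tadpole_sub_bubble` — `tadpole − bubble` IN ONE LIMIT**: `trace (perF A · perF (dper W)) − trace (perF A · perF (dper U) ·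
perF A · perF (dper V)) → tadpole A W − bubble A U V`. -/
theorem tendsto_trace_tadpole_sub_bubble (Mk : ℕ → (Fin (d + 1) → ℕ)) [∀ k μ, NeZero (Mk k μ)]
    (hMk : ∀ N : ℕ, ∀ᶠ k in atTop, ∀ i, N ≤ Mk k i) (hA : Decays A CA α) (hα : 0 < α)
    (hAinv : ∀ k (m x y : Fin (d + 1) → ℤ) (a b : F), A (translate (Mk k) x m) (translate (Mk k) y m) a b = A x y a b)
    (hU : BiLoc U p q CU δU) (hδU : 0 < δU) (hV : BiLoc V p' q' CV δV) (hδV : 0 < δV) (hW : BiLoc W p'' q'' CW δW) (hδW : 0 < δW) :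
    Tendsto (fun k => Matrix.trace (perF (Mk k) A * perF (Mk k) (dper (Mk k) W))
        - Matrix.trace (perF (Mk k) A * perF (Mk k) (dper (Mk k) U) * perF (Mk k) A * perF (Mk k) (dper (Mk k) V))) atTop
      (𝓝 (tadpole A W - bubble A U V)) :=
  (tendsto_trace_tadpole' Mk hMk hA hα hAinv hW hδW).sub (tendsto_trace_bubble' Mk hMk hA hα hAinv hU hδU hV hδV)

/-- [folklore] **`tendsto_two_mul_hessT_perF` — `2·hessT` OF THE PERIODISED LEG AGAINST PERIODISED JETS CONVERGES TO `tadpole − bubble`**: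
`2·hessT (perF A) (perF (dper U)) (perF (dper V)) (perF (dper W)) → tadpole A W − bubble A U V` (`MixedVarPackedHess.two_mul_hessT`: `2·hessT L V V′ W =
tr(L·W) − tr(L·V·(L·V′))`; `Matrix.mul_assoc` to (P2″)'s bracketing `L·V·L·V′`). -/
theorem tendsto_two_mul_hessT_perF (Mk : ℕ → (Fin (d + 1) → ℕ)) [∀ k μ, NeZero (Mk k μ)]
    (hMk : ∀ N : ℕ, ∀ᶠ k in atTop, ∀ i, N ≤ Mk k i) (hA : Decays A CA α) (hα : 0 < α)
    (hAinv : ∀ k (m x y : Fin (d + 1) → ℤ) (a b : F), A (translate (Mk k) x m) (translate (Mk k) y m) a b = A x y a b)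
    (hU : BiLoc U p q CU δU) (hδU : 0 < δU) (hV : BiLoc V p' q' CV δV) (hδV : 0 < δV) (hW : BiLoc W p'' q'' CW δW) (hδW : 0 < δW) :
    Tendsto (fun k => 2 * hessT (perF (Mk k) A) (perF (Mk k) (dper (Mk k) U)) (perF (Mk k) (dper (Mk k) V)) (perF (Mk k) (dper (Mk k) W))) atTop
      (𝓝 (tadpole A W - bubble A U V)) := by
  refine (tendsto_trace_tadpole_sub_bubble Mk hMk hA hα hAinv hU hδU hV hδV hW hδW).congr fun k => ?_
  rw [two_mul_hessT, Matrix.mul_assoc (perF (Mk k) A * perF (Mk k) (dper (Mk k) U))]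

/-- [folklore] **`tendsto_hessT_perF`**: `hessT (perF A) (perF (dper U)) (perF (dper V)) (perF (dper W)) → ½·(tadpole A W − bubble A U V)`. -/
theorem tendsto_hessT_perF (Mk : ℕ → (Fin (d + 1) → ℕ)) [∀ k μ, NeZero (Mk k μ)]
    (hMk : ∀ N : ℕ, ∀ᶠ k in atTop, ∀ i, N ≤ Mk k i) (hA : Decays A CA α) (hα : 0 < α)
    (hAinv : ∀ k (m x y : Fin (d + 1) → ℤ) (a b : F), A (translate (Mk k) x m) (translate (Mk k) y m) a b = A x y a b)
    (hU : BiLoc U p q CU δU) (hδU : 0 < δU) (hV : BiLoc V p' q' CV δV) (hδV : 0 < δV) (hW : BiLoc W p'' q'' CW δW) (hδW : 0 < δW) :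
    Tendsto (fun k => hessT (perF (Mk k) A) (perF (Mk k) (dper (Mk k) U)) (perF (Mk k) (dper (Mk k) V)) (perF (Mk k) (dper (Mk k) W))) atTop
      (𝓝 ((1 / 2 : ℝ) * (tadpole A W - bubble A U V))) := by
  have h := (tendsto_two_mul_hessT_perF Mk hMk hA hα hAinv hU hδU hV hδV hW hδW).const_mul (1 / 2 : ℝ)
  refine h.congr fun k => ?_
  ring

end HessT

/-! ## §3 For the base-point jet families of `hessKer`: the torus `hessT` converges to `hessKer A 𝒱 𝒲 μ ν z` -/

section HessKer

variable {A : MKer (d + 1) F} {CA Cv Cv' Cw α δ : ℝ} {p p' q q' : Fin (d + 1) → ℤ}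

/-- [folklore] **`tendsto_hessT_perF_hessKer` — THE POINT OF (P2‴)**: for the base-point families `𝒱`, `𝒲` of `ExpKernelCalculus.hessKer` (first jets `𝒱 μ 0`,
`𝒱 ν z`, mixed second jet `𝒲 μ 0 ν z`, bi-localised at a common rate `δ`) and an `Mkℤ`-invariant decaying leg `A`, the TORUS one-loop functional of the
periodised leg against the periodised jets converges to the ℤ^{d+1} resolvent Hessian kernel:
`hessT (perF A) (perF (dper (𝒱 μ 0))) (perF (dper (𝒱 ν z))) (perF (dper (𝒲 μ 0 ν z))) → hessKer A 𝒱 𝒲 μ ν z`. -/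
theorem tendsto_hessT_perF_hessKer (Mk : ℕ → (Fin (d + 1) → ℕ)) [∀ k μ, NeZero (Mk k μ)]
    (hMk : ∀ N : ℕ, ∀ᶠ k in atTop, ∀ i, N ≤ Mk k i) (hA : Decays A CA α) (hα : 0 < α)
    (hAinv : ∀ k (m x y : Fin (d + 1) → ℤ) (a b : F), A (translate (Mk k) x m) (translate (Mk k) y m) a b = A x y a b)
    (𝒱 : Fin (d + 1) → (Fin (d + 1) → ℤ) → MKer (d + 1) F) (𝒲 : Fin (d + 1) → (Fin (d + 1) → ℤ) → Fin (d + 1) → (Fin (d + 1) → ℤ) → MKer (d + 1) F)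
    (μ ν : Fin (d + 1)) (z : Fin (d + 1) → ℤ)
    (hV : BiLoc (𝒱 μ 0) p p' Cv δ) (hV' : BiLoc (𝒱 ν z) q' q Cv' δ) (hW : BiLoc (𝒲 μ 0 ν z) p q Cw δ) (hδ : 0 < δ) :
    Tendsto (fun k => hessT (perF (Mk k) A) (perF (Mk k) (dper (Mk k) (𝒱 μ 0))) (perF (Mk k) (dper (Mk k) (𝒱 ν z)))
        (perF (Mk k) (dper (Mk k) (𝒲 μ 0 ν z)))) atTop (𝓝 (hessKer A 𝒱 𝒲 μ ν z)) := by
  have h := tendsto_hessT_perF Mk hMk hA hα hAinv hV hδ hV' hδ hW hδ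
  have e : hessKer A 𝒱 𝒲 μ ν z = (1 / 2 : ℝ) * (tadpole A (𝒲 μ 0 ν z) - bubble A (𝒱 μ 0) (𝒱 ν z)) := by
    simp only [hessKer]; ring
  rw [e]; exact h

end HessKer

/-! ## §4 Composition with #23: a torus `hessT`-law on every box de-periodises to a `hessKer`-law

The three systems carry THREE box sequences `MkN MkF MkG` (each with its own growth clause) and three fibre types `FN FF FG` (the OWNER d1-p3 g22's
located ask W-FP-22-1, HOME/CLAIMS.log l.46427: the door (#24) hands the fine systems `N, F` over on `fine Lc M′`-boxes and the coarse system `G` on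
`M′`-boxes at the SAME `k`; #23's `law_of_tendsto` is three real sequences, so the generalisation is free). -/

section Law

open Summit.QuantumFields.BalabanUV.Beta.FP.KernelLawDeperiodised (law_of_tendsto)

variable {FN FF FG : Type*} [Fintype FN] [Fintype FF] [Fintype FG]
variable {AN : MKer (d + 1) FN} {AF : MKer (d + 1) FF} {AG : MKer (d + 1) FG}
  {CAN αN CAF αF CAG αG δN δF δG CvN CvN' CwN CvF CvF' CwF CvG CvG' CwG : ℝ}
  {pN pN' qN qN' pF pF' qF qF' pG pG' qG qG' : Fin (d + 1) → ℤ}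

/-- [folklore] **`hessKer_law_of_torus_hessT_law` — (L1)'s DE-PERIODISED LAW IN THE END's CURRENCY**: three systems (`X = N, F, G`), each an invariant decaying
leg `A_X` (fibre `F_X`) with base-point jet families `𝒱_X 𝒲_X` (bi-localised as in §3) along ITS OWN box sequence `Mk_X` (`∀ N, ∀ᶠ k, ∀ i, N ≤ Mk_X k i`);
if at EVERY `k` the torus one-loop functionals obey `hessT_N (MkN k) = hessT_F (MkF k) + hessT_G (MkG k)` (the (STEP) door through #24, legs and jets
written as `perF` ∕ `perF ∘ dper`), then `hessKer A_N 𝒱_N 𝒲_N μ ν z = hessKer A_F 𝒱_F 𝒲_F μ ν z + hessKer A_G 𝒱_G 𝒲_G μ ν z`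
(#23 `law_of_tendsto` on three `tendsto_hessT_perF_hessKer`). -/
theorem hessKer_law_of_torus_hessT_law (MkN MkF MkG : ℕ → (Fin (d + 1) → ℕ))
    [∀ k μ, NeZero (MkN k μ)] [∀ k μ, NeZero (MkF k μ)] [∀ k μ, NeZero (MkG k μ)]
    (hMkN : ∀ N : ℕ, ∀ᶠ k in atTop, ∀ i, N ≤ MkN k i) (hMkF : ∀ N : ℕ, ∀ᶠ k in atTop, ∀ i, N ≤ MkF k i)
    (hMkG : ∀ N : ℕ, ∀ᶠ k in atTop, ∀ i, N ≤ MkG k i)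
    (𝒱N : Fin (d + 1) → (Fin (d + 1) → ℤ) → MKer (d + 1) FN) (𝒱F : Fin (d + 1) → (Fin (d + 1) → ℤ) → MKer (d + 1) FF)
    (𝒱G : Fin (d + 1) → (Fin (d + 1) → ℤ) → MKer (d + 1) FG)
    (𝒲N : Fin (d + 1) → (Fin (d + 1) → ℤ) → Fin (d + 1) → (Fin (d + 1) → ℤ) → MKer (d + 1) FN)
    (𝒲F : Fin (d + 1) → (Fin (d + 1) → ℤ) → Fin (d + 1) → (Fin (d + 1) → ℤ) → MKer (d + 1) FF)
    (𝒲G : Fin (d + 1) → (Fin (d + 1) → ℤ) → Fin (d + 1) → (Fin (d + 1) → ℤ) → MKer (d + 1) FG)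
    (μ ν : Fin (d + 1)) (z : Fin (d + 1) → ℤ)
    (hAN : Decays AN CAN αN) (hαN : 0 < αN)
    (hANinv : ∀ k (m x y : Fin (d + 1) → ℤ) (a b : FN), AN (translate (MkN k) x m) (translate (MkN k) y m) a b = AN x y a b)
    (hVN : BiLoc (𝒱N μ 0) pN pN' CvN δN) (hVN' : BiLoc (𝒱N ν z) qN' qN CvN' δN) (hWN : BiLoc (𝒲N μ 0 ν z) pN qN CwN δN) (hδN : 0 < δN)
    (hAF : Decays AF CAF αF) (hαF : 0 < αF)
    (hAFinv : ∀ k (m x y : Fin (d + 1) → ℤ) (a b : FF), AF (translate (MkF k) x m) (translate (MkF k) y m) a b = AF x y a b)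
    (hVF : BiLoc (𝒱F μ 0) pF pF' CvF δF) (hVF' : BiLoc (𝒱F ν z) qF' qF CvF' δF) (hWF : BiLoc (𝒲F μ 0 ν z) pF qF CwF δF) (hδF : 0 < δF)
    (hAG : Decays AG CAG αG) (hαG : 0 < αG)
    (hAGinv : ∀ k (m x y : Fin (d + 1) → ℤ) (a b : FG), AG (translate (MkG k) x m) (translate (MkG k) y m) a b = AG x y a b)
    (hVG : BiLoc (𝒱G μ 0) pG pG' CvG δG) (hVG' : BiLoc (𝒱G ν z) qG' qG CvG' δG) (hWG : BiLoc (𝒲G μ 0 ν z) pG qG CwG δG) (hδG : 0 < δG)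
    (hlaw : ∀ k,
      hessT (perF (MkN k) AN) (perF (MkN k) (dper (MkN k) (𝒱N μ 0))) (perF (MkN k) (dper (MkN k) (𝒱N ν z)))
          (perF (MkN k) (dper (MkN k) (𝒲N μ 0 ν z))) =
        hessT (perF (MkF k) AF) (perF (MkF k) (dper (MkF k) (𝒱F μ 0))) (perF (MkF k) (dper (MkF k) (𝒱F ν z)))
            (perF (MkF k) (dper (MkF k) (𝒲F μ 0 ν z))) +
          hessT (perF (MkG k) AG) (perF (MkG k) (dper (MkG k) (𝒱G μ 0))) (perF (MkG k) (dper (MkG k) (𝒱G ν z)))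
            (perF (MkG k) (dper (MkG k) (𝒲G μ 0 ν z)))) :
    hessKer AN 𝒱N 𝒲N μ ν z = hessKer AF 𝒱F 𝒲F μ ν z + hessKer AG 𝒱G 𝒲G μ ν z :=
  law_of_tendsto (tendsto_hessT_perF_hessKer MkN hMkN hAN hαN hANinv 𝒱N 𝒲N μ ν z hVN hVN' hWN hδN)
    (tendsto_hessT_perF_hessKer MkF hMkF hAF hαF hAFinv 𝒱F 𝒲F μ ν z hVF hVF' hWF hδF)
    (tendsto_hessT_perF_hessKer MkG hMkG hAG hαG hAGinv 𝒱G 𝒲G μ ν z hVG hVG' hWG hδG) hlaw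

end Law

section LawFree

open Summit.QuantumFields.BalabanUV.Beta.FP.KernelLawDeperiodised (law_of_tendsto)

variable {FN FF FG : Type*} [Fintype FN] [Fintype FF] [Fintype FG]
variable {AN UN VN WN : MKer (d + 1) FN} {AF UF VF WF : MKer (d + 1) FF} {AG UG VG WG : MKer (d + 1) FG}
  {CAN αN CUN δUN CVN δVN CWN δWN CAF αF CUF δUF CVF δVF CWF δWF CAG αG CUG δUG CVG δVG CWG δWG : ℝ}
  {pN qN pN' qN' pN'' qN'' pF qF pF' qF' pF'' qF'' pG qG pG' qG' pG'' qG'' : Fin (d + 1) → ℤ}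

/-- [folklore] **`two_hessT_limit_law_of_torus_law`** — the same de-periodisation at the `tadpole − bubble` level for ARBITRARY bi-localised insertions
`U_X V_X W_X` (no family packaging; three box sequences, three fibres): a torus `2·hessT`-law at every `k` ⟹
`tadpole A_N W_N − bubble A_N U_N V_N = (tadpole A_F W_F − bubble A_F U_F V_F) + (tadpole A_G W_G − bubble A_G U_G V_G)`. -/
theorem two_hessT_limit_law_of_torus_law (MkN MkF MkG : ℕ → (Fin (d + 1) → ℕ))
    [∀ k μ, NeZero (MkN k μ)] [∀ k μ, NeZero (MkF k μ)] [∀ k μ, NeZero (MkG k μ)]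
    (hMkN : ∀ N : ℕ, ∀ᶠ k in atTop, ∀ i, N ≤ MkN k i) (hMkF : ∀ N : ℕ, ∀ᶠ k in atTop, ∀ i, N ≤ MkF k i)
    (hMkG : ∀ N : ℕ, ∀ᶠ k in atTop, ∀ i, N ≤ MkG k i)
    (hAN : Decays AN CAN αN) (hαN : 0 < αN)
    (hANinv : ∀ k (m x y : Fin (d + 1) → ℤ) (a b : FN), AN (translate (MkN k) x m) (translate (MkN k) y m) a b = AN x y a b)
    (hUN : BiLoc UN pN qN CUN δUN) (hδUN : 0 < δUN) (hVN : BiLoc VN pN' qN' CVN δVN) (hδVN : 0 < δVN)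
    (hWN : BiLoc WN pN'' qN'' CWN δWN) (hδWN : 0 < δWN)
    (hAF : Decays AF CAF αF) (hαF : 0 < αF)
    (hAFinv : ∀ k (m x y : Fin (d + 1) → ℤ) (a b : FF), AF (translate (MkF k) x m) (translate (MkF k) y m) a b = AF x y a b)
    (hUF : BiLoc UF pF qF CUF δUF) (hδUF : 0 < δUF) (hVF : BiLoc VF pF' qF' CVF δVF) (hδVF : 0 < δVF)
    (hWF : BiLoc WF pF'' qF'' CWF δWF) (hδWF : 0 < δWF)
    (hAG : Decays AG CAG αG) (hαG : 0 < αG)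
    (hAGinv : ∀ k (m x y : Fin (d + 1) → ℤ) (a b : FG), AG (translate (MkG k) x m) (translate (MkG k) y m) a b = AG x y a b)
    (hUG : BiLoc UG pG qG CUG δUG) (hδUG : 0 < δUG) (hVG : BiLoc VG pG' qG' CVG δVG) (hδVG : 0 < δVG)
    (hWG : BiLoc WG pG'' qG'' CWG δWG) (hδWG : 0 < δWG)
    (hlaw : ∀ k,
      2 * hessT (perF (MkN k) AN) (perF (MkN k) (dper (MkN k) UN)) (perF (MkN k) (dper (MkN k) VN)) (perF (MkN k) (dper (MkN k) WN)) =
        2 * hessT (perF (MkF k) AF) (perF (MkF k) (dper (MkF k) UF)) (perF (MkF k) (dper (MkF k) VF)) (perF (MkF k) (dper (MkF k) WF)) +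
        2 * hessT (perF (MkG k) AG) (perF (MkG k) (dper (MkG k) UG)) (perF (MkG k) (dper (MkG k) VG)) (perF (MkG k) (dper (MkG k) WG))) :
    tadpole AN WN - bubble AN UN VN = (tadpole AF WF - bubble AF UF VF) + (tadpole AG WG - bubble AG UG VG) :=
  law_of_tendsto (tendsto_two_mul_hessT_perF MkN hMkN hAN hαN hANinv hUN hδUN hVN hδVN hWN hδWN)
    (tendsto_two_mul_hessT_perF MkF hMkF hAF hαF hAFinv hUF hδUF hVF hδVF hWF hδWF)
    (tendsto_two_mul_hessT_perF MkG hMkG hAG hαG hAGinv hUG hδUG hVG hδVG hWG hδWG) hlaw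

end LawFree

end Summit.QuantumFields.BalabanUV.Beta.FP.KernelPeriodisationFibHessKer

end
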